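import Literature.Probability.RandomPlanarGeometry.HexSAWBrickWallStripFugacityTwoWallOrder
import Literature.Probability.RandomPlanarGeometry.HexSAWBrickWallStripFugacityTwoSidedProp6
import HarnessLib

/-!
# The two-wall tower below its top: `y + 3/(10√y) ≤ μ_2(y,y)²`, and the one-wall strip windows `y ≤ μ_T(y,1)² ≤ y + 6/y` (`T ≥ 3`)

Topic `Literature/Probability/RandomPlanarGeometry` (continues `HexSAWBrickWallStripFugacityTwoWallOrder.lean` — the uniform upper windows
`μ_T(y,y)² ≤ y + 4/(√y−1)` (`T ≥ 2`, `y ≥ 4`), `μ_T(y,y)² ≤ y + 6/y` (`T ≥ 3`, `y ≥ 25`) and the width-two switch words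
`mul_pow_le_stripMuY₂_self_pow` of `…TwoWallSwitch` — and `HexSAWBrickWallStripFugacityTwoSidedProp6.lean`: monotonicity of
`μ_T(y,z)` in `z`).  Source of the objects: N. R. Beaton, M. Bousquet-Mélou, J. de Gier, H. Duminil-Copin, A. J. Guttmann,
Comm. Math. Phys. 326 (2014), arXiv:1109.0358v5, §3.2 Proposition 6 (p. 10: `μ_T(y,z)`, non-decreasing in `y` and `z`, symmetric)
and Proposition 7 (p. 11: the one-variable rates `μ_T(1,y) = μ_T(y,1)`, `HexBW.stripMuY₀ T y`).  New in writing (modest,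
elementary): the explicit lower window at width TWO and the typed one-wall windows, uniform in the width.  (The width-ONE
windows of the tower are exact — `HexSAWBrickWallStripFugacityWidthOneExact.lean`, `μ_1(y,y)³ = yμ_1 + y` — and are not
repeated here.)

## Statements (namespace `Literature.Probability.RandomPlanarGeometry.SAW.HexBW`, all PROVED, standard axioms)

* ★ **`stripMuY₂_two_self_sq_ge`** — `25 ≤ y → y + 3/(10√y) ≤ μ_2(y,y)²` (the width-two switch words with `m = ⌊3y√y⌋ + 1`
  units: `(m·y^m)² ≤ μ_2(y,y)^{2(2m+3)}` against `(1 + 0.3/(y√y))^{2m+3} < e² < 9 < m²/y³`);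
* ★ **`stripMuY₂_two_self_sq_window`** — `25 ≤ y → μ_2(y,y)² − y ∈ [3/(10√y), 4/(√y − 1)]`: the width-two correction is
  between the orders `y^{−1/2}` and `y^{−1/2}` up to constants (`0.3` vs `≈ 4`);
* `sq_stripMuY₀_mem_Icc` — `1 ≤ y → μ_T(y,1)² ∈ [y, μ_T(y,y)²]` (zig-zag below; Proposition 6's monotonicity in `z` above);
* ★ **`sq_stripMuY₀_mem_Icc_of_three_le`** — `3 ≤ T → 25 ≤ y → μ_T(y,1)² ∈ [y, y + 6/y]`: ONE attractive wall is entropy-free to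
  order `1/y`, uniformly in the width `T ≥ 3`; `sq_stripMuY₀_mem_Icc_of_two_le` — `2 ≤ T → 4 ≤ y → μ_T(y,1)² ∈ [y, y + 4/(√y−1)]`.
-/

noncomputable section

open Filter Topology Finset Literature.Probability.LatticeModels Literature.Probability.Percolation SimpleGraph

namespace Literature.Probability.RandomPlanarGeometry.SAW.HexBW

variable {y : ℝ}

/-! ### §1 The width-two lower window `y + 3/(10√y) ≤ μ_2(y,y)²` (`y ≥ 25`) -/

/-- `(1 + x)^n ≤ exp(n·x)` for `x ≥ 0`. [folklore] -/
private theorem one_add_pow_le_exp_mul' {x : ℝ} (hx : 0 ≤ x) (n : ℕ) : (1 + x) ^ n ≤ Real.exp (n * x) := by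
  calc (1 + x) ^ n ≤ (Real.exp x) ^ n := pow_le_pow_left₀ (by linarith) (by linarith [Real.add_one_le_exp x]) n
    _ = Real.exp (n * x) := (Real.exp_nat_mul x n).symm

/-- `exp 2 < 9`. [folklore] -/
private theorem exp_two_lt_nine : Real.exp 2 < 9 := by
  have h := Real.exp_one_lt_d9
  have h0 := (Real.exp_pos 1).le
  calc Real.exp 2 = Real.exp 1 ^ 2 := by rw [← Real.exp_nat_mul]; norm_num
    _ < 9 := by nlinarith

/-- ★ **`y + 3/(10√y) ≤ μ_2(y,y)²` for every `y ≥ 25`** (the width-two staircase switch walks with `m = ⌊3y√y⌋ + 1`): with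
`μ_2(y,y)² ≤ y + 4/(√y − 1)`, the width-two correction is of order EXACTLY `1/√y`. [cite: BeatonBousquetMelouDeGierDuminilCopinGuttmann2014, §3.2 Proposition 6 (arXiv v5 p. 10)] -/
theorem stripMuY₂_two_self_sq_ge (hy : 25 ≤ y) : y + 3 / (10 * Real.sqrt y) ≤ stripMuY₂ 2 y y ^ 2 := by
  have hy0 : 0 < y := by linarith
  have hy1 : 1 ≤ y := by linarith
  have hs5 : 5 ≤ Real.sqrt y := by
    rw [show (5:ℝ) = Real.sqrt 25 by rw [show (25:ℝ) = 5 ^ 2 by norm_num, Real.sqrt_sq (by norm_num)]]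
    exact Real.sqrt_le_sqrt hy
  have hs0 : 0 < Real.sqrt y := by linarith
  have hsy : Real.sqrt y ^ 2 = y := Real.sq_sqrt hy0.le
  set m : ℕ := ⌊3 * y * Real.sqrt y⌋₊ + 1 with hm
  have hm1 : 1 ≤ m := by omega
  have hm_gt : 3 * y * Real.sqrt y < m := by rw [hm]; push_cast; exact Nat.lt_floor_add_one _
  have hm_le : (m : ℝ) ≤ 3 * y * Real.sqrt y + 1 := by
    rw [hm]; push_cast; linarith [Nat.floor_le (by positivity : 0 ≤ 3 * y * Real.sqrt y)]
  set x : ℝ := 3 / (10 * (y * Real.sqrt y)) with hx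
  have hx0 : 0 ≤ x := by rw [hx]; positivity
  have hw : y + 3 / (10 * Real.sqrt y) = y * (1 + x) := by
    rw [hx]; field_simp
  have hnx : ((2 * m + 3 : ℕ) : ℝ) * x ≤ 2 := by
    push_cast
    rw [hx, mul_div_assoc', div_le_iff₀ (by positivity)]
    have k1 : y * Real.sqrt y ≥ 125 := by nlinarith
    nlinarith
  have hexp : (1 + x) ^ (2 * m + 3) < 9 :=
    ((one_add_pow_le_exp_mul' hx0 _).trans (Real.exp_le_exp.2 hnx)).trans_lt exp_two_lt_nine
  have hm2 : 9 * y ^ 3 < (m : ℝ) ^ 2 := by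
    have : (3 * y * Real.sqrt y) ^ 2 = 9 * y ^ 3 := by rw [mul_pow, mul_pow, hsy]; ring
    rw [← this]
    exact pow_lt_pow_left₀ hm_gt (by positivity) two_ne_zero
  have hμ := (stripMuY₂_pos 2 hy0 hy0).le
  have hB := mul_pow_le_stripMuY₂_self_pow (T := 2) (by norm_num) hy1 hm1
  rw [show 2 * m + 2 * 2 - 1 = 2 * m + 3 by omega] at hB
  have hc0 : (0 : ℝ) ≤ (m : ℝ) * y ^ (m : ℕ) := by positivity
  have key : (y + 3 / (10 * Real.sqrt y)) ^ (2 * m + 3) < (stripMuY₂ 2 y y ^ 2) ^ (2 * m + 3) := by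
    calc (y + 3 / (10 * Real.sqrt y)) ^ (2 * m + 3) = y ^ (2 * m + 3) * (1 + x) ^ (2 * m + 3) := by rw [hw, mul_pow]
      _ < y ^ (2 * m + 3) * 9 := mul_lt_mul_of_pos_left hexp (by positivity)
      _ = 9 * y ^ 3 * y ^ (2 * m) := by ring
      _ < (m : ℝ) ^ 2 * y ^ (2 * m) := mul_lt_mul_of_pos_right hm2 (by positivity)
      _ = ((m : ℝ) * y ^ (m : ℕ)) ^ 2 := by ring
      _ ≤ (stripMuY₂ 2 y y ^ (2 * m + 3)) ^ 2 := pow_le_pow_left₀ hc0 hB 2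
      _ = (stripMuY₂ 2 y y ^ 2) ^ (2 * m + 3) := by rw [← pow_mul, ← pow_mul, mul_comm]
  exact (lt_of_pow_lt_pow_left₀ _ (by positivity) key).le

/-- ★ **`μ_2(y,y)² − y ∈ [3/(10√y), 4/(√y − 1)]` for every `y ≥ 25`.** [cite: BeatonBousquetMelouDeGierDuminilCopinGuttmann2014, §3.2 Proposition 6 (arXiv v5 p. 10)] -/
theorem stripMuY₂_two_self_sq_window (hy : 25 ≤ y) :
    stripMuY₂ 2 y y ^ 2 - y ∈ Set.Icc (3 / (10 * Real.sqrt y)) (4 / (Real.sqrt y - 1)) := by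
  have h3 := stripMuY₂_two_self_sq_ge hy
  have h4 := stripMuY₂_self_sq_le_of_two_le (T := 2) le_rfl (by linarith : (4:ℝ) ≤ y)
  exact ⟨by linarith, by linarith⟩

/-! ### §2 One attractive wall (the printed `μ_T(y,1) = μ_T(1,y)`): the windows by monotonicity in the second fugacity -/

/-- **`y ≤ μ_T(y,1)² ≤ μ_T(y,y)²`** (zig-zag; monotonicity of Proposition 6 in `z`). [cite: BeatonBousquetMelouDeGierDuminilCopinGuttmann2014, §3.2 Proposition 6 (arXiv v5 p. 10: μ_T(y,z) non-decreasing in z; μ_T(y,1) = μ_T(1,y)) and Corollary 8 (p. 12: the zig-zag bound)] -/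
theorem sq_stripMuY₀_mem_Icc (T : ℕ) (hy : 1 ≤ y) : stripMuY₀ T y ^ 2 ∈ Set.Icc y (stripMuY₂ T y y ^ 2) := by
  have hy0 : 0 < y := by linarith
  have h1 := sqrt_le_stripMuY₀ T hy
  have h2 : stripMuY₀ T y ≤ stripMuY₂ T y y := by
    rw [← stripMuY₂_one_right]; exact stripMuY₂_mono_right T hy0 one_pos hy
  have hμ0 := (stripMuY₀_pos T hy0).le
  constructor
  · have := pow_le_pow_left₀ (Real.sqrt_nonneg y) h1 2
    rwa [Real.sq_sqrt hy0.le] at this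
  · exact pow_le_pow_left₀ hμ0 h2 2

/-- ★ **The one-wall strip rates are entropy-free to order `1/y`, uniformly in the width: `y ≤ μ_T(y,1)² ≤ y + 6/y` for every `T ≥ 3`,
`y ≥ 25`** (Proposition 7's `μ_T(1,y) = μ_T(y,1)`). [cite: BeatonBousquetMelouDeGierDuminilCopinGuttmann2014, §3.2 Propositions 6–7 (arXiv v5 pp. 10–11)] -/
theorem sq_stripMuY₀_mem_Icc_of_three_le {T : ℕ} (hT : 3 ≤ T) (hy : 25 ≤ y) : stripMuY₀ T y ^ 2 ∈ Set.Icc y (y + 6 / y) :=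
  ⟨(sq_stripMuY₀_mem_Icc T (by linarith)).1,
    (sq_stripMuY₀_mem_Icc T (by linarith)).2.trans (stripMuY₂_self_sq_le_of_three_le hT hy)⟩

/-- **`y ≤ μ_T(y,1)² ≤ y + 4/(√y − 1)` for every `T ≥ 2`, `y ≥ 4`.** [cite: BeatonBousquetMelouDeGierDuminilCopinGuttmann2014, §3.2 Propositions 6–7 (arXiv v5 pp. 10–11)] -/
theorem sq_stripMuY₀_mem_Icc_of_two_le {T : ℕ} (hT : 2 ≤ T) (hy : 4 ≤ y) : stripMuY₀ T y ^ 2 ∈ Set.Icc y (y + 4 / (Real.sqrt y - 1)) :=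
  ⟨(sq_stripMuY₀_mem_Icc T (by linarith)).1,
    (sq_stripMuY₀_mem_Icc T (by linarith)).2.trans (stripMuY₂_self_sq_le_of_two_le hT hy)⟩

end Literature.Probability.RandomPlanarGeometry.SAW.HexBW
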